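import Summits.KontsevichZagierPeriods.KontsevichZagierPeriods.Theorems.HermiteRigidityReductionRigidityTorusGen
import Literature.NumberTheory.Transcendental.KZGroundingRelations

/-!
# KontsevichZagierPeriods / HermiteRigidity — crux `ReductionRigidity` (stmt-KontsevichZagierPeriods-3407), line `Sketch` (Padé box island, every weight): MONOMIALS and the BALANCED DIVISION

Route `KontsevichZagierPeriods/HermiteRigidity`, crux stmt-KontsevichZagierPeriods-3407, crux-chain line `Sketch`
(skeleton `Cruxes/ReductionRigidity/Lines/Sketch.lean`, v7: the `(w, 1/N)` box island in every weight).
Two stubs of the general reduction: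

* `stub_monomialGen` — monomials are rational constants in every dimension,
  `[□ʲ, q·x^a] ≡ [pt, q/∏ₗ(aₗ + 1)]`: induction on `j`, one cubical Stokes move along the last coordinate per
  step (the torus leg `torusGen_leg` at pole order `0`), `∏` bookkeeping by `Fin.prod_univ_castSucc`;
* `stub_divisionGen` — the balanced division at pole order one, PURE rule 1b:
  `[q·u^c/(N − u)] ≡ [q N^c/(N − u)] − Σ_{i<c} [q N^{c−1−i}·u^i]` (`u = x₀⋯x_{j−1}`), from
  `u^c − N^c = (u − N)·Σ_{i<c} u^i N^{c−1−i}` (`geom_sum₂_mul`).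

References: M. Kontsevich, D. Zagier, *Periods* (2001), §1.2 rules (1), (3) [cite: KontsevichZagier2001, §1.2];
J. Ayoub, EMS Newsl. 91 (2014), Def. 10 [cite: Ayoub2014, Def. 10].
-/

noncomputable section

open MeasureTheory Set MvPolynomial

namespace Summit.KontsevichZagierPeriods.HermiteRigidity.ReductionRigidity

open Literature.NumberTheory.Transcendental
open Literature.NumberTheory.Transcendental.KZ

/-- **STUB `monomialGen` (PROVED): monomials on the closed cube are rational constants**,
`[□ʲ, q·x^a] ≡ [pt, q/∏ₗ(aₗ + 1)]` in `KZ.relations`. [cite: KontsevichZagier2001, §1.2 rule (3)]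
[cite: Ayoub2014, Def. 10] -/
theorem stub_monomialGen : ∀ (j : ℕ) (q : ℚ) (a : Fin j → ℕ) (r : IntegralRep j) (s₀ : IntegralRep 0),
    r.domain = cube j → EqOn r.integrand (fun p => (q : ℝ) * ∏ l, p l ^ a l) (cube j) →
    s₀.domain = cube 0 → EqOn s₀.integrand (fun _ => ((q / ∏ l, ((a l : ℚ) + 1) : ℚ) : ℝ)) (cube 0) →
    KZ.of r - KZ.of s₀ ∈ KZ.relations := by
  intro j
  induction j with
  | zero =>
    intro q a r s₀ hr hri hs₀ hs₀i
    refine of_sub_of_mem_relations_of_eqOn (hs₀.trans hr.symm) fun p hp => ?_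
    rw [hr] at hp
    rw [hri hp, hs₀i hp]
    simp
  | succ j ih =>
    intro q a r s₀ hr hri hs₀ hs₀i
    have hpos : ((a (Fin.last j) : ℚ) + 1) ≠ 0 := by positivity
    -- Stokes along the last coordinate: the torus leg at pole order `0` (any `N ≥ 2`, say `N = 2`)
    set c : ℚ := q / ((a (Fin.last j) : ℚ) + 1) with hc
    obtain ⟨r₁, hr₁, hr₁i⟩ : ∃ r₁ : IntegralRep j, r₁.domain = cube j ∧
        EqOn r₁.integrand (fun p => (c : ℝ) * (∏ l, p l ^ a ((Fin.last j).succAbove l)) /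
          (((2 : ℚ) : ℝ) - ∏ l, p l) ^ 0) (cube j) :=
      ⟨(RFun.poly (C c * ∏ l, X l ^ a (Fin.castSucc l)) : RFun j).rep, rfl, fun p _ => by
        simp [RFun.rep_integrand, map_prod, Fin.succAbove_last]⟩
    have h2 : (1 : ℚ) < 2 ∨ (2 : ℚ) < 0 := Or.inl (by norm_num)
    obtain ⟨T, hT, hleg⟩ := torusGen_leg h2 c a 0 (Fin.last j) r₁ hr₁ hr₁i
    -- `[r] ≡ [∂_L T]` (pointwise: `q x^a = c (a_L + 1) x^a`)
    have h1 : KZ.of r - KZ.of (T.pd (Fin.last j)).rep ∈ KZ.relations := by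
      refine of_sub_of_mem_relations_of_eqOn (by rw [RFun.rep_domain, hr]) fun p hp => ?_
      rw [hr] at hp
      rw [hri hp, RFun.rep_integrand, hT p hp, hc]
      have hden : ((2 : ℚ) : ℝ) - ∏ l, p l ≠ 0 := torusGen_sub_prod_ne h2 hp
      have hpos' : ((a (Fin.last j) : ℝ) + 1) ≠ 0 := by positivity
      have hden' : (2 : ℝ) - ∏ l, p l ≠ 0 := by exact_mod_cast hden
      push_cast
      field_simp
      ring
    -- the face `[r₁] ≡ [pt, c/∏_{l<j}(a_l + 1)] = [pt, q/∏_l(a_l + 1)]` by the induction hypothesis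
    have hface : KZ.of r₁ - KZ.of s₀ ∈ KZ.relations := by
      refine ih c (fun l => a (Fin.castSucc l)) r₁ s₀ hr₁ (fun p hp => ?_) hs₀ (fun p hp => ?_)
      · rw [hr₁i hp]; simp [Fin.succAbove_last]
      · rw [hs₀i hp, hc, Fin.prod_univ_castSucc]
        push_cast
        field_simp
    have : KZ.of r - KZ.of s₀ =
        (KZ.of r - KZ.of (T.pd (Fin.last j)).rep) + (KZ.of (T.pd (Fin.last j)).rep - KZ.of r₁) +
          (KZ.of r₁ - KZ.of s₀) := by abel
    rw [this]
    exact KZ.relations.add_mem (KZ.relations.add_mem h1 hleg) hface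

/-- **The balanced division identity** at a rational level `ν`: for `ν − u ≠ 0`,
`q ν^c/(ν − u) = q·u^c/(ν − u) + Σ_{i<c} q ν^{c−1−i} u^i`. [folklore] -/
theorem divisionGen_identity (ν : ℚ) (q : ℚ) (c : ℕ) {u : ℝ} (hu : (ν : ℝ) - u ≠ 0) :
    ((q * ν ^ c : ℚ) : ℝ) / ((ν : ℝ) - u) =
      (q : ℝ) * u ^ c / ((ν : ℝ) - u) + ∑ i ∈ Finset.range c, ((q * ν ^ (c - 1 - i) : ℚ) : ℝ) * u ^ i := by
  have hgeom := geom_sum₂_mul u (ν : ℝ) c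
  push_cast
  rw [div_add' _ _ _ hu, div_eq_div_iff hu hu]
  have hS : (∑ i ∈ Finset.range c, (q : ℝ) * (ν : ℝ) ^ (c - 1 - i) * u ^ i) =
      (q : ℝ) * ∑ i ∈ Finset.range c, u ^ i * (ν : ℝ) ^ (c - 1 - i) := by
    rw [Finset.mul_sum]
    exact Finset.sum_congr rfl fun i _ => by ring
  rw [hS]
  linear_combination (q : ℝ) * ((ν : ℝ) - u) * hgeom

/-- **The balanced division at pole order one, at a RATIONAL level `ν > 1` or `ν < 0`** (pure rule 1b):
`[q u^c/(ν−u)] ≡ [q ν^c/(ν−u)] − Σ_{i<c} [q ν^{c−1−i} u^i]`. [cite: KontsevichZagier2001, §1.2 rule (1)] -/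
theorem divisionGen : ∀ (j : ℕ) (ν : ℚ), (1 < ν ∨ ν < 0) → ∀ (q : ℚ) (c : ℕ) (r s : IntegralRep j)
    (t : ℕ → IntegralRep j),
    r.domain = cube j →
    EqOn r.integrand (fun p => (q : ℝ) * (∏ l, p l ^ c) / ((ν : ℝ) - ∏ l, p l) ^ 1) (cube j) →
    s.domain = cube j →
    EqOn s.integrand (fun p => ((q * ν ^ c : ℚ) : ℝ) * (∏ l, p l ^ (0 : ℕ)) / ((ν : ℝ) - ∏ l, p l) ^ 1)
      (cube j) →
    (∀ i < c, (t i).domain = cube j ∧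
      EqOn (t i).integrand (fun p => ((q * ν ^ (c - 1 - i) : ℚ) : ℝ) * (∏ l, p l ^ i) /
        ((ν : ℝ) - ∏ l, p l) ^ 0) (cube j)) →
    KZ.of r - (KZ.of s - ∑ i ∈ Finset.range c, KZ.of (t i)) ∈ KZ.relations := by
  intro j ν hν q c r s t hr hri hs hsi ht
  -- the polynomial part as ONE representation `P = Σ_{i<c} q ν^{c−1−i} u^i`
  set P : IntegralRep j := (RFun.poly (∑ i ∈ Finset.range c, C (q * ν ^ (c - 1 - i)) * (∏ l, X l) ^ i) :
    RFun j).rep with hP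
  have hPi : ∀ p : Fin j → ℝ, P.integrand p =
      ∑ i ∈ Finset.range c, ((q * ν ^ (c - 1 - i) : ℚ) : ℝ) * (∏ l, p l) ^ i := by
    intro p
    simp only [hP, RFun.rep_integrand, RFun.fn_poly, map_sum, map_mul, aeval_C, eq_ratCast, map_pow,
      map_prod, aeval_X]
    push_cast
    rfl
  -- (1) `[P] ≡ Σ [t i]` (iterated rule 1b)
  have h1 : KZ.of P - ∑ i ∈ Finset.range c, KZ.of (t i) ∈ KZ.relations := by
    refine of_sub_sum_integrand_mem_relations (Finset.range c) t P
      (fun i hi => by rw [(ht i (Finset.mem_range.1 hi)).1, hP, RFun.rep_domain]) fun p hp => ?_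
    rw [hP, RFun.rep_domain] at hp
    rw [hPi]
    refine Finset.sum_congr rfl fun i hi => ?_
    have := (ht i (Finset.mem_range.1 hi)).2 hp
    simp only [this, Finset.prod_pow, pow_zero, div_one]
  -- (2) `[s] ≡ [r] + [P]` (rule 1b with the division identity)
  have h2 : KZ.of s - KZ.of r - KZ.of P ∈ KZ.relations := by
    refine integrandAddRel_subset_relations ⟨j, s, r, P, hr.trans hs.symm, by rw [hP, RFun.rep_domain, hs],
      fun p hp => ?_, rfl⟩
    rw [hs] at hp
    have hu : (ν : ℝ) - ∏ l, p l ≠ 0 := torusGen_sub_prod_ne hν hp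
    rw [Pi.add_apply, hsi hp, hri hp, hPi]
    simp only [Finset.prod_pow, pow_zero, pow_one, Finset.prod_const_one, mul_one]
    exact divisionGen_identity ν q c hu
  have : KZ.of r - (KZ.of s - ∑ i ∈ Finset.range c, KZ.of (t i)) =
      -(KZ.of s - KZ.of r - KZ.of P) - (KZ.of P - ∑ i ∈ Finset.range c, KZ.of (t i)) := by abel
  rw [this]
  exact KZ.relations.sub_mem (KZ.relations.neg_mem h2) h1

/-- **STUB `divisionGen` (PROVED; the integer-level form `N ≥ 2`): the balanced division at pole order
one** (pure rule 1b). [cite: KontsevichZagier2001, §1.2 rule (1)] -/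
theorem stub_divisionGen : ∀ (j N : ℕ), 2 ≤ N → ∀ (q : ℚ) (c : ℕ) (r s : IntegralRep j)
    (t : ℕ → IntegralRep j),
    r.domain = cube j →
    EqOn r.integrand (fun p => (q : ℝ) * (∏ l, p l ^ c) / ((N : ℝ) - ∏ l, p l) ^ 1) (cube j) →
    s.domain = cube j →
    EqOn s.integrand (fun p => ((q * (N : ℚ) ^ c : ℚ) : ℝ) * (∏ l, p l ^ (0 : ℕ)) / ((N : ℝ) - ∏ l, p l) ^ 1)
      (cube j) →
    (∀ i < c, (t i).domain = cube j ∧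
      EqOn (t i).integrand (fun p => ((q * (N : ℚ) ^ (c - 1 - i) : ℚ) : ℝ) * (∏ l, p l ^ i) /
        ((N : ℝ) - ∏ l, p l) ^ 0) (cube j)) →
    KZ.of r - (KZ.of s - ∑ i ∈ Finset.range c, KZ.of (t i)) ∈ KZ.relations := by
  intro j N hN q c r s t hr hri hs hsi ht
  have hν : (1 : ℚ) < N ∨ (N : ℚ) < 0 := Or.inl (by exact_mod_cast hN)
  exact divisionGen j N hν q c r s t hr (fun p hp => by rw [hri hp]; push_cast; rfl) hs
    (fun p hp => by rw [hsi hp]; push_cast; rfl)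
    (fun i hi => ⟨(ht i hi).1, fun p hp => by rw [(ht i hi).2 hp]; push_cast; rfl⟩)

end Summit.KontsevichZagierPeriods.HermiteRigidity.ReductionRigidity

end
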